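import Mathlib
import Summits.ValiantsHypothesis.ValiantsHypothesis.Theorems.NewtonUnitEquationsDissociatedUniformTotalsLawLargeThirdPointwise
import HarnessLib

/-!
# Crux `NewtonUnitEquations.DissociatedUniform` (stmt-ValiantsHypothesis-5905): the dominant-third-curve regime POINTWISE — lower half

Companion of `…TotalsLawLargeThirdPointwise` (upper half: for `λ ≥ λ₀` every hull vertex of class `s` of `(a, b, λ•c)` comes from a pair
`(z, x)` with a common WEAK-top direction).  Here the converse inclusion for STRICT directions and an injective third curve:

* `StrictCommonDir a b c s z x` — one weight at which `c z` is the strict top of `C` (over the other labels) and the fibre point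
  `bpt z x = a x + b(s − z − x)` is the strict top of `P_{s−z}` (over the other POINTS of the fibre);
* `exists_lambda_mem_extremePoints` — such a pair is a hull vertex `λ c z + bpt z x` of the class for all `λ ≥ λ₀(z,x)` (the gap of `c z`
  at the weight, times `λ`, beats every fibre pairing);
* **`card_image_strictCommonDir_le_classVert_smul`** — hence for `λ ≥ λ₀` the class has at least as many hull vertices as there are
  POINTS `λ c z + bpt z x` over pairs with a strict common direction.
Together (general position, where weak = strict and the point map is injective): in the regime `V_s = #{(z, v) : v a vertex of P_{s−z}
whose normal cone meets the cone of c z}` `= q + Σ_z #(edge normals of P_{s−z} inside K_z)` — the formula behind the `q²/2` witness family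
and the co-oriented `≤ 3q` census of NOTES-t1g8 §2.
Honest label: regime theorem; `CoOrientedClassBound`, `SmoothSharpTotalsLaw`, `TotalsLawThree` OPEN; nothing here bears on VP ≠ VNP.
[folklore: exposed points are extreme]
-/

set_option linter.dupNamespace false -- `ValiantsHypothesis.ValiantsHypothesis` (summit = problem) in every name

open scoped BigOperators

namespace Summit.ValiantsHypothesis.ValiantsHypothesis.Theorems.NewtonUnitEquationsDissociatedUniform

namespace TotalsLaw

open Literature.Computability.AlgebraicComplexity.KPTT.PlanarMinkowski

section LargeThirdPointwiseLower

variable {q : ℕ} [NeZero q] (a b c : ZMod q → (Fin 2 → ℝ)) (s : ZMod q)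

/-- **Strict common direction** of the letter `z` of the third curve and the fibre point `bpt z x`: a weight exposing `c z` strictly
among the letters of `C` and `bpt z x` strictly among the POINTS of its fibre. -/
def StrictCommonDir (z x : ZMod q) : Prop :=
  ∃ θ : Fin 2 → ℝ, (∀ z', z' ≠ z → θ ⬝ᵥ c z' < θ ⬝ᵥ c z) ∧
    (∀ x', bpt a b s z x' ≠ bpt a b s z x → θ ⬝ᵥ bpt a b s z x' < θ ⬝ᵥ bpt a b s z x)

omit [NeZero q] in
/-- A strict common direction is a common (weak) direction (for `q ≥ 2`, so that the weight is non-zero). [folklore] -/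
theorem StrictCommonDir.commonDir {z x : ZMod q} (hq : 2 ≤ q) (h : StrictCommonDir a b c s z x) : CommonDir a b c s z x := by
  obtain ⟨θ, hC, hP⟩ := h
  have hz1 : z + 1 ≠ z := by
    intro h1
    have : (1 : ZMod q) = 0 := by linear_combination h1
    have h1' : ((1 : ℕ) : ZMod q) = 0 := by exact_mod_cast this
    rw [ZMod.natCast_eq_zero_iff] at h1'
    exact absurd (Nat.le_of_dvd (by norm_num) h1') (by omega)
  refine ⟨θ, ?_, fun z' => ?_, fun x' => ?_⟩
  · intro h0
    have := hC (z + 1) hz1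
    rw [h0, zero_dotProduct, zero_dotProduct] at this
    exact lt_irrefl _ this
  · by_cases hz : z' = z
    · rw [hz]
    · exact (hC z' hz).le
  · by_cases hx : bpt a b s z x' = bpt a b s z x
    · rw [hx]
    · exact (hP x' hx).le

/-- **Lower half, per pair.**  With an injective third curve, a pair with a strict common direction gives a hull vertex
`λ c z + bpt z x` of the class of `(a, b, λ•c)` for all large `λ`. [folklore] -/
theorem exists_lambda_mem_extremePoints {z x : ZMod q} (h : StrictCommonDir a b c s z x) :
    ∃ μ₀ : ℝ, ∀ μ : ℝ, μ₀ ≤ μ →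
      μ • c z + bpt a b s z x ∈ (convexHull ℝ (classPts a b (μ • c) s)).extremePoints ℝ := by
  classical
  obtain ⟨θ, hC, hP⟩ := h
  -- a bound for all fibre pairings
  set B : ℝ := Finset.univ.sup' Finset.univ_nonempty fun zx : ZMod q × ZMod q => |θ ⬝ᵥ bpt a b s zx.1 zx.2| with hB
  have hBle : ∀ z' x', |θ ⬝ᵥ bpt a b s z' x'| ≤ B := fun z' x' =>
    Finset.le_sup' (fun zx : ZMod q × ZMod q => |θ ⬝ᵥ bpt a b s zx.1 zx.2|) (Finset.mem_univ (z', x'))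
  -- a threshold beating every OTHER blob
  have hthr : ∃ μ₀ : ℝ, ∀ μ : ℝ, μ₀ ≤ μ → ∀ z', z' ≠ z → ∀ x',
      μ * (θ ⬝ᵥ c z') + θ ⬝ᵥ bpt a b s z' x' < μ * (θ ⬝ᵥ c z) + θ ⬝ᵥ bpt a b s z x := by
    by_cases hne : (Finset.univ.filter fun z' : ZMod q => z' ≠ z).Nonempty
    · set g : ℝ := (Finset.univ.filter fun z' : ZMod q => z' ≠ z).inf' hne fun z' => θ ⬝ᵥ c z - θ ⬝ᵥ c z' with hg
      have hgpos : 0 < g := by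
        obtain ⟨z₁, hz₁, hz₁eq⟩ := Finset.exists_mem_eq_inf' hne fun z' => θ ⬝ᵥ c z - θ ⬝ᵥ c z'
        rw [hg, hz₁eq]
        have := hC z₁ (Finset.mem_filter.1 hz₁).2
        linarith
      have hgle : ∀ z', z' ≠ z → g ≤ θ ⬝ᵥ c z - θ ⬝ᵥ c z' := by
        intro z' hz'
        have hmem : z' ∈ Finset.univ.filter (fun z'' : ZMod q => z'' ≠ z) :=
          Finset.mem_filter.2 ⟨Finset.mem_univ _, hz'⟩
        exact Finset.inf'_le (fun z'' => θ ⬝ᵥ c z - θ ⬝ᵥ c z'') hmem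
      refine ⟨(2 * B + 1) / g, fun μ hμ z' hz' x' => ?_⟩
      have hμg : 2 * B + 1 ≤ μ * g := by rwa [div_le_iff₀ hgpos] at hμ
      have h1 := hgle z' hz'
      have h2 := abs_le.1 (hBle z' x')
      have h3 := abs_le.1 (hBle z x)
      have hμ0 : 0 ≤ μ := by
        have hB0 : 0 ≤ B := (abs_nonneg _).trans (hBle z x)
        exact le_trans (by positivity) hμ
      nlinarith
    · refine ⟨0, fun μ _ z' hz' x' => ?_⟩
      exact absurd ⟨z', Finset.mem_filter.2 ⟨Finset.mem_univ _, hz'⟩⟩ hne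
  obtain ⟨μ₀, hkey⟩ := hthr
  refine ⟨μ₀, fun μ hμ => ?_⟩
  rw [← coe_classFin]
  refine IsStrictTop.mem_extremePoints (w := θ) ⟨smul_add_bpt_mem a b c s μ z x, fun y hy hne' => ?_⟩
  obtain ⟨⟨x', y'⟩, -, rfl⟩ := Finset.mem_image.1 hy
  have hrepr : a x' + b y' + (μ • c) (s - x' - y') = μ • c (s - x' - y') + bpt a b s (s - x' - y') x' := by
    rw [bpt, Pi.smul_apply]
    have : s - (s - x' - y') - x' = y' := by ring
    rw [this]; abel
  rw [hrepr] at hne' ⊢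
  rw [dotProduct_add, dotProduct_add, dotProduct_smul, dotProduct_smul, smul_eq_mul, smul_eq_mul]
  by_cases hzz : s - x' - y' = z
  · -- same blob: compare inside the fibre, by points
    rw [hzz] at hne' ⊢
    have hvne : bpt a b s z x' ≠ bpt a b s z x := fun hv => hne' (by rw [hv])
    have := hP x' hvne
    linarith
  · exact hkey μ hμ _ hzz x'

/-- **Lower half.**  For `λ ≥ λ₀` the class `s` of `(a, b, λ•c)` has at least as many hull vertices as there are distinct points
`λ c z + bpt z x` over the pairs `(z, x)` with a strict common direction. [folklore] -/
theorem card_image_strictCommonDir_le_classVert_smul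
    [DecidablePred fun zx : ZMod q × ZMod q => StrictCommonDir a b c s zx.1 zx.2] :
    ∃ μ₀ : ℝ, ∀ μ : ℝ, μ₀ ≤ μ →
      ((Finset.univ.filter fun zx : ZMod q × ZMod q => StrictCommonDir a b c s zx.1 zx.2).image
          fun zx => μ • c zx.1 + bpt a b s zx.1 zx.2).card ≤ classVert a b (μ • c) s := by
  classical
  have hpair : ∀ zx : ZMod q × ZMod q, ∃ μ₀ : ℝ, StrictCommonDir a b c s zx.1 zx.2 → ∀ μ : ℝ, μ₀ ≤ μ →
      μ • c zx.1 + bpt a b s zx.1 zx.2 ∈ (convexHull ℝ (classPts a b (μ • c) s)).extremePoints ℝ := by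
    intro zx
    by_cases h : StrictCommonDir a b c s zx.1 zx.2
    · obtain ⟨μ₀, hμ₀⟩ := exists_lambda_mem_extremePoints a b c s h
      exact ⟨μ₀, fun _ => hμ₀⟩
    · exact ⟨0, fun h' => absurd h' h⟩
  choose lam hlam using hpair
  refine ⟨Finset.univ.sup' Finset.univ_nonempty lam, fun μ hμ => ?_⟩
  unfold classVert
  rw [← Set.ncard_coe_finset]
  refine Set.ncard_le_ncard (fun p hp => ?_) ((Set.finite_range _).subset extremePoints_convexHull_subset)
  obtain ⟨zx, hzx, rfl⟩ := Finset.mem_image.1 (Finset.mem_coe.1 hp)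
  have hμ' : lam zx ≤ μ := (Finset.le_sup' lam (Finset.mem_univ zx)).trans hμ
  exact hlam zx (Finset.mem_filter.1 hzx).2 μ hμ'

end LargeThirdPointwiseLower

end TotalsLaw

end Summit.ValiantsHypothesis.ValiantsHypothesis.Theorems.NewtonUnitEquationsDissociatedUniform
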